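import Summits.KontsevichZagierPeriods.KontsevichZagierPeriods.Theorems.SymplecticScissorsVolumeFormOffPlaneUnionSplit

/-!
# `VolumeFormOffPlane` (stmt-KontsevichZagierPeriods-14935) — line `Sketch`,
stub `stub_cornerCut` (corner cut: inclusion–exclusion of translated orthants)

Pointwise signed decomposition of a log-box cut by one binomial wall into its `2ⁿ` corner
cells.  For a point `p : Fin (n + 1) → ℝ` (torus coordinates `x ι = p (Fin.castSucc ι)`, slack
`z = p (Fin.last n)`) off the walls `x ι = b ι`, and `a ι ≤ b ι`,

`1_{∀ ι, a ι < x ι < b ι ∧ K}(p) = ∑_{S ⊆ Fin n} (-1)^{#S} · 1_{∀ ι, e_S ι < x ι ∧ K}(p)`,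

where `e_S ι = b ι` on `S`, `a ι` off `S`, and `K` is the common conjunct (the cut
`∏ x ι ^ m ι < c` and the slack conditions `0 < z`, `z · ∏ x ι < 1`).

Proof (pure combinatorics): with `A ι = 1_{a ι < x ι}`, `B ι = 1_{b ι < x ι}` one has
`1_{a ι < x ι < b ι} = A ι - B ι` (as `a ι ≤ b ι` and `x ι ≠ b ι`); the indicator of the
conjunction over `ι` is the product `∏ ι (A ι - B ι)`, which expands (`Finset.prod_sub`) as
`∑_S (-1)^{#S} ∏_{ι ∈ S} B ι ∏_{ι ∉ S} A ι`, and each summand is the indicator of the corner cell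
`S`.  The common conjunct `K` is either true (and drops out) or false (and both sides vanish).

Sources: folklore (inclusion–exclusion of translated orthants).
-/

noncomputable section

open MeasureTheory Set
open Literature.NumberTheory.Transcendental

namespace Summit.KontsevichZagierPeriods.SymplecticScissors.LogPolytope

/-- The `0/1`-indicator of a universally quantified predicate over `Fin n` is the product of the
`0/1`-indicators of its instances. [folklore] -/
theorem cc_boole_forall {n : ℕ} (P : Fin n → Prop) [DecidablePred P] [Decidable (∀ ι, P ι)] :
    (if (∀ ι, P ι) then (1 : ℝ) else 0) = ∏ ι, (if P ι then (1 : ℝ) else 0) := by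
  split_ifs with h
  · symm
    exact Finset.prod_eq_one fun ι _ => if_pos (h ι)
  · push Not at h
    obtain ⟨ι, hι⟩ := h
    symm
    apply Finset.prod_eq_zero (Finset.mem_univ ι)
    exact if_neg hι

/-- Off the wall `x = b`, with `a ≤ b`: `1_{a < x < b} = 1_{a < x} - 1_{b < x}`. [folklore] -/
theorem cc_boole_Ioo_sub {a b x : ℝ} (hab : a ≤ b) (hxb : x ≠ b)
    [Decidable (a < x ∧ x < b)] [Decidable (a < x)] [Decidable (b < x)] :
    (if (a < x ∧ x < b) then (1 : ℝ) else 0) =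
      (if a < x then (1 : ℝ) else 0) - (if b < x then (1 : ℝ) else 0) := by
  by_cases hax : a < x
  · by_cases hbx : b < x
    · rw [if_neg (fun h => lt_irrefl x (h.2.trans hbx)), if_pos hax, if_pos hbx, sub_self]
    · rw [if_pos ⟨hax, lt_of_le_of_ne (not_lt.mp hbx) hxb⟩, if_pos hax, if_neg hbx, sub_zero]
  · rw [if_neg (fun h => hax h.1), if_neg hax, if_neg (fun h => hax (hab.trans_lt h)), sub_self]

/-- Product expansion of a product of differences over `Fin n`, indexed by subsets:
`∏ ι (f ι - g ι) = ∑_S (-1)^{#S} ∏ ι (if ι ∈ S then g ι else f ι)`. [folklore] -/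
theorem cc_prod_sub_univ {n : ℕ} (f g : Fin n → ℝ) :
    ∏ ι, (f ι - g ι) =
      ∑ S : Finset (Fin n), (-1 : ℝ) ^ S.card * ∏ ι, (if ι ∈ S then g ι else f ι) := by
  rw [Finset.prod_sub, Finset.powerset_univ]
  refine Finset.sum_congr rfl fun S _ => ?_
  have h1 : ∏ ι ∈ S, (if ι ∈ S then g ι else f ι) = ∏ ι ∈ S, g ι :=
    Finset.prod_congr rfl fun ι hι => if_pos hι
  have h2 : ∏ ι ∈ Sᶜ, (if ι ∈ S then g ι else f ι) = ∏ ι ∈ Finset.univ \ S, f ι := by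
    rw [Finset.compl_eq_univ_sdiff]
    exact Finset.prod_congr rfl fun ι hι => if_neg (Finset.mem_sdiff.mp hι).2
  rw [← Finset.prod_mul_prod_compl S (fun ι => if ι ∈ S then g ι else f ι), h1, h2]
  ring

/-- The corner-cut identity for `0/1`-indicators written as `if`s: off the walls `x ι = b ι`,
with `a ι ≤ b ι`, `1_{∀ ι, a ι < x ι < b ι} = ∑_S (-1)^{#S} 1_{∀ ι, e_S ι < x ι}`. [folklore] -/
theorem cc_corner_boole {n : ℕ} (a b x : Fin n → ℝ) (hab : ∀ ι, a ι ≤ b ι)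
    (hxb : ∀ ι, x ι ≠ b ι) [Decidable (∀ ι, a ι < x ι ∧ x ι < b ι)]
    [∀ S : Finset (Fin n), Decidable (∀ ι, (if ι ∈ S then b ι else a ι) < x ι)] :
    (if (∀ ι, a ι < x ι ∧ x ι < b ι) then (1 : ℝ) else 0) =
      ∑ S : Finset (Fin n), (-1 : ℝ) ^ S.card *
        (if (∀ ι, (if ι ∈ S then b ι else a ι) < x ι) then (1 : ℝ) else 0) := by
  classical
  rw [cc_boole_forall (fun ι => a ι < x ι ∧ x ι < b ι),
    Finset.prod_congr rfl fun ι _ => cc_boole_Ioo_sub (hab ι) (hxb ι), cc_prod_sub_univ]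
  refine Finset.sum_congr rfl fun S _ => ?_
  rw [cc_boole_forall (fun ι => (if ι ∈ S then b ι else a ι) < x ι)]
  congr 1
  refine Finset.prod_congr rfl fun ι _ => ?_
  by_cases h : ι ∈ S
  · simp only [h, if_true]
  · simp only [h, if_false]

/-- **Corner cut (inclusion–exclusion of translated orthants).** Off the null walls
`x_ι = b_ι`, the indicator of a log-box cut by one binomial wall is the alternating sum over
`S ⊆ Fin n` of the indicators of the corner cells `{e_S < x, x^m < c}` (`e_S ι = b ι` on `S`,
`a ι` off `S`) with the same slack: the product expansion of `∏_ι (1_{a_ι < x_ι} − 1_{b_ι < x_ι})`;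
the cut and the slack are a common factor. Pure combinatorics. [folklore] -/
theorem stub_cornerCut : ∀ (n : ℕ) (a b : Fin n → ℝ) (m : Fin n → ℕ) (c : ℝ) (p : Fin (n + 1) → ℝ),
    (∀ ι, a ι ≤ b ι) → (∀ ι, p (Fin.castSucc ι) ≠ b ι) →
    {q : Fin (n + 1) → ℝ | (∀ ι : Fin n, a ι < q (Fin.castSucc ι) ∧ q (Fin.castSucc ι) < b ι) ∧
        ∏ ι : Fin n, q (Fin.castSucc ι) ^ (m ι) < c ∧ 0 < q (Fin.last n) ∧
        q (Fin.last n) * ∏ ι : Fin n, q (Fin.castSucc ι) < 1}.indicator (fun _ => (1 : ℝ)) p =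
      ∑ S : Finset (Fin n), (-1 : ℝ) ^ S.card *
        {q : Fin (n + 1) → ℝ | (∀ ι : Fin n, (if ι ∈ S then b ι else a ι) < q (Fin.castSucc ι)) ∧
          ∏ ι : Fin n, q (Fin.castSucc ι) ^ (m ι) < c ∧ 0 < q (Fin.last n) ∧
          q (Fin.last n) * ∏ ι : Fin n, q (Fin.castSucc ι) < 1}.indicator (fun _ => (1 : ℝ)) p := by
  intro n a b m c p hab hpb
  classical
  simp only [Set.indicator_apply, Set.mem_setOf_eq]
  by_cases hK : (∏ ι : Fin n, p (Fin.castSucc ι) ^ (m ι) < c ∧ 0 < p (Fin.last n) ∧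
      p (Fin.last n) * ∏ ι : Fin n, p (Fin.castSucc ι) < 1)
  · simp only [hK, and_true]
    exact cc_corner_boole a b (fun ι => p (Fin.castSucc ι)) hab hpb
  · simp only [hK, and_false, if_false, mul_zero, Finset.sum_const_zero]

end Summit.KontsevichZagierPeriods.SymplecticScissors.LogPolytope

end
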